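import Summits.BirchSwinnertonDyer.BirchSwinnertonDyer.Theorems.EisensteinPrimesKatzLineFlatFactor
import HarnessLib

/-!
# The FAR regime of an `𝓞_{ℂ_p}⟦T⟧`-series with a unit coefficient, far points of `ℂ_p`, and the ORDER at
# `0` under the `p`-power-map functional equation `L(Φ)·Q^p = L^p·Q(Φ)`
# (helper file for crux `GoodLatticeBDPValue`, stmt-BirchSwinnertonDyer-19032, line `halves`, piece AN-F₂)

Seat `bsd-line-x1-p1-w4` (D-0154 width seat on crux 2 of route `EisensteinPrimes`, line `halves` v17;
ideator card `Cruxes/GoodLatticeBDPValue/Lines/halves_anDS_split_idea11g4` rev 2, piece AN-F₂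
`KatzLineDescentAt`, route (RIG)). Second of the pure-analysis files behind the `λ`-rigidity theorem
`…KatzLineLambdaRigidity.firstUnitCoeffAt_eq_of_powMap_identity` (see that file for the argument).
THEOREMS ONLY (elementary `p`-adic analysis on `𝓞_{ℂ_p}⟦T⟧`; no definition, no named fact, no `sorry`;
imports no `Theses` module). `--supports stmt-BirchSwinnertonDyer-19032`.

* §1 **far regime** `norm_value_eq_pow_of_coeff_lt`: if `‖[T^m]Q‖ = 1` and every earlier coefficient has
  norm `< ‖y‖^m` then `‖Q(y)‖ = ‖y‖^m` (tail decomposition `Q(y) = Σ_{i<m}[T^i]Q y^i + y^m t_m`,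
  `‖t_m‖ = 1`); `exists_bound_lt_one`; **`exists_far_point`**: for `c < 1` there is `y ∈ ℂ_p` with
  `0 < ‖y‖ < 1` and `c < ‖y‖^m` (an `N`-th root of `p`; `ℂ_p` is algebraically closed in Mathlib).
* §2 **orders**: `order_subst_powMap` (`ord F(Φ) = ord F`: `[T^n]F(Φ) = p^n [T^n]F` at the order, b2b
  `Additive.coeff_subst_one_add_X_pow_sub_one_of_forall_lt`), `order_pow_eq`,
  `order_eq_of_powMap_identity` (`ord Q = ord L`), `constantCoeff_eq_zero_iff_of_powMap_identity`.

References: [Washington1997] §7.1 Prop. 7.2, §7.2 (the `p`-power map); [Cassels1986] Ch. 4 Lemma 2.1;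
[Gouvea1993PadicNumbers] §5.6.
-/

set_option linter.dupNamespace false
set_option autoImplicit false

noncomputable section

open scoped Classical Topology
open Filter PowerSeries Literature.NumberTheory.EllipticCurves
  Summit.BirchSwinnertonDyer.Rank1Residual Summit.BirchSwinnertonDyer.Rank1Residual.X11b

namespace Summit.BirchSwinnertonDyer.BirchSwinnertonDyer.Theorems.KatzLineRigidity

variable {p : ℕ} [hp : Fact p.Prime]

/-! ### §1 The far regime of a bounded series; far points of `ℂ_p` -/

/-- **Far regime**: if `‖[T^m]Q‖ = 1` and every earlier coefficient has norm `< ‖y‖^m` (`‖y‖ < 1`),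
then `‖Q(y)‖ = ‖y‖^m`: writing `Q(y) = Σ_{i<m} [T^i]Q y^i + y^m·t_m` with the tail
`t_m = [T^m]Q + y·t_{m+1}` of norm `1`, the finite part has norm `< ‖y‖^m`. [cite: Washington1997, §7.1 Prop. 7.2] -/
theorem norm_value_eq_pow_of_coeff_lt {Q : PowerSeries 𝓞_ℂ_[p]} {m : ℕ} {y v : ℂ_[p]} (hy : ‖y‖ < 1)
    (hm : ‖((coeff m Q : 𝓞_ℂ_[p]) : ℂ_[p])‖ = 1)
    (hfar : ∀ i < m, ‖((coeff i Q : 𝓞_ℂ_[p]) : ℂ_[p])‖ < ‖y‖ ^ m) (hv : IntSeries.HasValueAt Q y v) :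
    ‖v‖ = ‖y‖ ^ m := by
  -- the tails `t k = Σ_i [T^{i+k}]Q y^i`
  set t : ℕ → ℂ_[p] := fun k ↦ ∑' i : ℕ, ((coeff (i + k) Q : 𝓞_ℂ_[p]) : ℂ_[p]) * y ^ i with ht_def
  have ht : ∀ k, IntSeries.HasValueAt (PowerSeries.mk fun i ↦ coeff (i + k) Q) y (t k) :=
    fun k ↦ hasValueAt_tail Q hy k
  have hrec : ∀ k, t k = ((coeff k Q : 𝓞_ℂ_[p]) : ℂ_[p]) + y * t (k + 1) :=
    fun k ↦ tail_eq k (ht k) (ht (k + 1))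
  have hv0 : v = t 0 := by
    refine hv.unique ?_
    have := ht 0
    unfold IntSeries.HasValueAt at this ⊢
    simpa only [coeff_mk, add_zero] using this
  -- iterate the recursion: `t 0 = Σ_{i<j} [T^i]Q y^i + y^j · t j`
  have hiter : ∀ j : ℕ, t 0 = (∑ i ∈ Finset.range j, ((coeff i Q : 𝓞_ℂ_[p]) : ℂ_[p]) * y ^ i) +
      y ^ j * t j := by
    intro j
    induction j with
    | zero => simp
    | succ j ih => rw [ih, Finset.sum_range_succ, hrec j, pow_succ]; ring
  -- the tail `t m` has norm `1`
  have htm : ‖t m‖ = 1 := by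
    have hle : ‖t (m + 1)‖ ≤ 1 := norm_value_le_one hy.le (ht (m + 1))
    have hsmall : ‖y * t (m + 1)‖ < 1 := by
      rw [norm_mul]
      calc ‖y‖ * ‖t (m + 1)‖ ≤ ‖y‖ * 1 := by gcongr
        _ < 1 := by rw [mul_one]; exact hy
    rw [hrec m]
    have hne : ‖((coeff m Q : 𝓞_ℂ_[p]) : ℂ_[p])‖ ≠ ‖y * t (m + 1)‖ := by
      rw [hm]; exact (ne_of_lt hsmall).symm
    rw [IsUltrametricDist.norm_add_eq_max_of_norm_ne_norm hne, hm, max_eq_left hsmall.le]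
  -- the finite part has norm `< ‖y‖^m`
  have hmain : ‖y ^ m * t m‖ = ‖y‖ ^ m := by rw [norm_mul, norm_pow, htm, mul_one]
  have hfin : ‖∑ i ∈ Finset.range m, ((coeff i Q : 𝓞_ℂ_[p]) : ℂ_[p]) * y ^ i‖ < ‖y‖ ^ m := by
    rcases Nat.eq_zero_or_pos m with rfl | hmpos
    · simp
    have hypos : 0 < ‖y‖ ^ m := by
      have h0 := hfar 0 hmpos
      exact lt_of_le_of_lt (norm_nonneg _) h0
    refine X2.CpIntSeries.norm_sum_lt _ hypos fun i hi ↦ ?_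
    rw [Finset.mem_range] at hi
    rw [norm_mul, norm_pow]
    calc ‖((coeff i Q : 𝓞_ℂ_[p]) : ℂ_[p])‖ * ‖y‖ ^ i ≤ ‖((coeff i Q : 𝓞_ℂ_[p]) : ℂ_[p])‖ * 1 := by
          gcongr; exact pow_le_one₀ (norm_nonneg _) hy.le
      _ < ‖y‖ ^ m := by rw [mul_one]; exact hfar i hi
  rw [hv0, hiter m]
  have hne : ‖∑ i ∈ Finset.range m, ((coeff i Q : 𝓞_ℂ_[p]) : ℂ_[p]) * y ^ i‖ ≠ ‖y ^ m * t m‖ := by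
    rw [hmain]; exact ne_of_lt hfin
  rw [IsUltrametricDist.norm_add_eq_max_of_norm_ne_norm hne, hmain, max_eq_right hfin.le]

/-- A finite family of reals `< 1` is bounded by some `c < 1`. [folklore] -/
theorem exists_bound_lt_one {f : ℕ → ℝ} {m : ℕ} (h : ∀ i < m, f i < 1) :
    ∃ c : ℝ, 0 ≤ c ∧ c < 1 ∧ ∀ i < m, f i ≤ c := by
  induction m with
  | zero => exact ⟨0, le_rfl, zero_lt_one, fun i hi ↦ absurd hi (Nat.not_lt_zero i)⟩
  | succ m ih =>
    obtain ⟨c, hc0, hc1, hc⟩ := ih fun i hi ↦ h i (Nat.lt_succ_of_lt hi)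
    refine ⟨max c (f m), le_max_of_le_left hc0, max_lt hc1 (h m (Nat.lt_succ_self m)), fun i hi ↦ ?_⟩
    rcases Nat.lt_succ_iff_lt_or_eq.mp hi with hlt | rfl
    · exact (hc i hlt).trans (le_max_left _ _)
    · exact le_max_right _ _

/-- **Points in the far regime exist**: for `c < 1` and `m` there is `y ∈ ℂ_p` with `0 < ‖y‖ < 1` and
`c < ‖y‖^m` — an `N`-th root of `p` (`ℂ_p` is algebraically closed) with `c^N < p^{−m}`. [folklore] -/
theorem exists_far_point {c : ℝ} (hc0 : 0 ≤ c) (hc : c < 1) (m : ℕ) :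
    ∃ y : ℂ_[p], 0 < ‖y‖ ∧ ‖y‖ < 1 ∧ c < ‖y‖ ^ m := by
  have hpnorm : ‖((p : ℕ) : ℂ_[p])‖ = (p : ℝ)⁻¹ :=
    Literature.NumberTheory.LFunctions.Dwork.norm_natCast_p_padicComplex
  have hp1 : 1 < (p : ℝ) := by exact_mod_cast hp.out.one_lt
  have hpinv0 : 0 < (p : ℝ)⁻¹ := inv_pos.mpr (by linarith)
  have hpinv1 : (p : ℝ)⁻¹ < 1 := inv_lt_one_of_one_lt₀ hp1
  obtain ⟨N, hN⟩ := exists_pow_lt_of_lt_one (pow_pos hpinv0 m) hc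
  -- `N ≠ 0` since `c^0 = 1 > p^{-m}` is impossible... ensure `N ≠ 0` by enlarging
  have hN' : c ^ (N + 1) < ((p : ℝ)⁻¹) ^ m :=
    lt_of_le_of_lt (pow_le_pow_of_le_one hc0 hc.le (Nat.le_succ N)) hN
  obtain ⟨y, hy⟩ := IsAlgClosed.exists_pow_nat_eq ((p : ℕ) : ℂ_[p]) (Nat.succ_pos N)
  have hyN : ‖y‖ ^ (N + 1) = (p : ℝ)⁻¹ := by rw [← norm_pow, hy, hpnorm]
  have hy0 : 0 < ‖y‖ := by
    rcases (norm_nonneg y).lt_or_eq with h | h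
    · exact h
    · exfalso
      rw [← h, zero_pow (Nat.succ_ne_zero N)] at hyN
      exact hpinv0.ne hyN
  have hy1 : ‖y‖ < 1 := by
    by_contra hge
    push Not at hge
    have : 1 ≤ ‖y‖ ^ (N + 1) := one_le_pow₀ hge
    rw [hyN] at this
    exact absurd (this.trans_lt hpinv1) (lt_irrefl 1)
  refine ⟨y, hy0, hy1, ?_⟩
  by_contra hle
  push Not at hle
  -- `(‖y‖^m)^{N+1} ≤ c^{N+1} < p^{-m} = (‖y‖^{N+1})^m`
  have h1 : (‖y‖ ^ m) ^ (N + 1) ≤ c ^ (N + 1) :=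
    pow_le_pow_left₀ (pow_nonneg (norm_nonneg _) _) hle _
  have h2 : ((p : ℝ)⁻¹) ^ m = (‖y‖ ^ m) ^ (N + 1) := by rw [← hyN, ← pow_mul, ← pow_mul, mul_comm]
  rw [h2] at hN'
  exact absurd (h1.trans_lt hN') (lt_irrefl _)

/-! ### §2 Orders under the power map; `Q(0) = 0 ⇔ L(0) = 0` -/

/-- **The power map preserves the order**: `ord (F(Φ)) = ord F` for `F ∈ 𝓞_{ℂ_p}⟦T⟧`, `Φ = (1+T)^p − 1`
(`[T^n]F(Φ) = p^n·[T^n]F` at the order `n`, earlier coefficients vanish; `𝓞_{ℂ_p}` has characteristic `0`).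
[cite: Washington1997, §7.2 (the p-power map)] -/
theorem order_subst_powMap {F : PowerSeries 𝓞_ℂ_[p]} (hF : F ≠ 0) :
    PowerSeries.order (F.subst (((1 + X : PowerSeries 𝓞_ℂ_[p]) ^ p) - 1)) = F.order := by
  set n := F.order.toNat with hn
  have hFn : F.order = n := (coe_toNat_order hF).symm
  rw [hFn, PowerSeries.order_eq_nat]
  have hlow : ∀ k < n, coeff k F = 0 := fun k hk ↦ coeff_of_lt_order_toNat k hk
  constructor
  · rw [Additive.coeff_subst_one_add_X_pow_sub_one_of_forall_lt p hlow]
    refine mul_ne_zero (pow_ne_zero _ ?_) (coeff_order hF)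
    exact_mod_cast hp.out.ne_zero
  · intro i hi
    rw [Additive.coeff_subst_one_add_X_pow_sub_one_of_forall_lt p (fun k hk ↦ hlow k (hk.trans hi)),
      hlow i hi, mul_zero]

/-- The order of a power in the domain `𝓞_{ℂ_p}⟦T⟧`: `ord (F^n) = n • ord F`. [folklore] -/
theorem order_pow_eq (F : PowerSeries 𝓞_ℂ_[p]) (n : ℕ) : (F ^ n).order = n • F.order := by
  induction n with
  | zero => simp
  | succ n ih => rw [pow_succ, order_mul, ih, succ_nsmul]

/-- **`ord Q = ord L` under the functional equation** `L(Φ)·Q^p = L^p·Q(Φ)` (`Q, L ≠ 0`): orders add in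
the domain `𝓞_{ℂ_p}⟦T⟧`, `Φ` preserves them, so `ord L + p·ord Q = p·ord L + ord Q`. [folklore] -/
theorem order_eq_of_powMap_identity {Q L : PowerSeries 𝓞_ℂ_[p]} (hQ : Q ≠ 0) (hL : L ≠ 0)
    (h : L.subst (((1 + X : PowerSeries 𝓞_ℂ_[p]) ^ p) - 1) * Q ^ p =
      L ^ p * Q.subst (((1 + X : PowerSeries 𝓞_ℂ_[p]) ^ p) - 1)) :
    Q.order = L.order := by
  have ho : PowerSeries.order (L.subst (((1 + X : PowerSeries 𝓞_ℂ_[p]) ^ p) - 1) * Q ^ p) =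
      PowerSeries.order (L ^ p * Q.subst (((1 + X : PowerSeries 𝓞_ℂ_[p]) ^ p) - 1)) := by rw [h]
  rw [PowerSeries.order_mul, PowerSeries.order_mul, order_subst_powMap hL, order_subst_powMap hQ,
    order_pow_eq, order_pow_eq] at ho
  set a := Q.order.toNat with ha
  set b := L.order.toNat with hb
  have hQa : Q.order = a := (coe_toNat_order hQ).symm
  have hLb : L.order = b := (coe_toNat_order hL).symm
  rw [hQa, hLb] at ho ⊢
  have ho' : (b : ℕ∞) + ((p * a : ℕ) : ℕ∞) = ((p * b : ℕ) : ℕ∞) + (a : ℕ∞) := by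
    simpa only [nsmul_eq_mul, Nat.cast_mul] using ho
  have hnat : b + p * a = p * b + a := by exact_mod_cast ho'
  have hp2 : 2 ≤ p := hp.out.two_le
  have : a = b := by
    have h1 : (p - 1) * a = (p - 1) * b := by
      zify [hp.out.one_le] at hnat ⊢
      linarith
    exact Nat.eq_of_mul_eq_mul_left (by omega) h1
  rw [this]

/-- Under the functional equation, `Q(0) = 0 ⇔ L(0) = 0` (`Q, L ≠ 0`). [folklore] -/
theorem constantCoeff_eq_zero_iff_of_powMap_identity {Q L : PowerSeries 𝓞_ℂ_[p]} (hQ : Q ≠ 0)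
    (hL : L ≠ 0)
    (h : L.subst (((1 + X : PowerSeries 𝓞_ℂ_[p]) ^ p) - 1) * Q ^ p =
      L ^ p * Q.subst (((1 + X : PowerSeries 𝓞_ℂ_[p]) ^ p) - 1)) :
    constantCoeff Q = 0 ↔ constantCoeff L = 0 := by
  have ho := order_eq_of_powMap_identity hQ hL h
  rw [← coeff_zero_eq_constantCoeff_apply, ← coeff_zero_eq_constantCoeff_apply]
  constructor
  · intro h0
    apply coeff_of_lt_order
    rw [← ho]
    by_contra hle
    push Not at hle
    have := order_le 0 (φ := Q)
    -- `Q.order ≤ 0` would force `coeff 0 Q ≠ 0`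
    have hQ0 : Q.order = 0 := le_antisymm (by exact_mod_cast hle) bot_le
    have := order_eq_nat.mp hQ0
    exact this.1 h0
  · intro h0
    apply coeff_of_lt_order
    rw [ho]
    by_contra hle
    push Not at hle
    have hL0 : L.order = 0 := le_antisymm (by exact_mod_cast hle) bot_le
    exact (order_eq_nat.mp hL0).1 h0

end Summit.BirchSwinnertonDyer.BirchSwinnertonDyer.Theorems.KatzLineRigidity

end
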